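import Summits.Ventures.PercRepro.S1DisjointSumThreeSixProfile

/-!
# PercRepro — THE PROFILES OF THE `(4, 5)` SPLIT: RANK-2 SETS ARE FEW IN A COLOOP-FREE MATROID (p2, gen 28;
SUBCLAIM-S1 §6.10 (xvii)(j))

What the `(4, 5)`-split consumer (`S1DisjointSumFourFive`) needs. General: a set of rank `k < r` in a coloop-free
matroid of rank `r` misses at least `r − k + 1` points (`sub_add_one_le_ncard_ground_sdiff_of_coloops` — the
two-points lemma of `S1RankProfileDoubleCount` at every level), so in rank `4` on `7` points the closure of a pair has
at most `4` points and every rank-`2` set at most `4`; THE INCIDENCE DOUBLE COUNT: the rank-`2` sets with at least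
`3` points number at most `C(|E|, 2)` (each contains at least `3` pairs, each pair lies in at most `3` of them —
the nonempty subsets of the `≤ 2` further points of its closure); a coloop-free matroid of rank `r` on `n` points
has at least `n + 1` spanning sets. For the rank-`4` part `M` on `7` points: `f(2) ≤ 42`, `N_M(4, 2) ≤ 42`,
`f(2) + f(3) + f(4) ≥ 120`, hence `f(3) + f(4) ≥ 78`. Nothing is claimed about any cell.

* `sub_add_one_le_ncard_ground_sdiff_of_coloops`, `ncard_closure_pair_le_of_coloops'`;
* `bigRankTwo`, `bigPairs`, **`ncard_bigRankTwo_le_choose`** — the incidence double count;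
* `succ_le_ncard_rankSet_top_of_coloops` — `n + 1` spanning sets;
* `ncard_rankSet_two_le_of_big`, `ncard_profileSet_four_two_le_add`, `ncard_rankSet_two_three_four_ge_of_pairs` —
  the `M`-side.
Axioms: standard.
-/

open scoped Matroid

namespace PercRepro

namespace S1

open Set

variable {α : Type}

/-- **A rank-`k` set misses at least `r − k + 1` points** in a coloop-free matroid of rank `r > k`: were only
`r − k` points outside `X`, any one of them `y` would satisfy `ρ(E ∖ y) ≤ ρ(X) + (r − k − 1) < r`, a coloop. -/
theorem sub_add_one_le_ncard_ground_sdiff_of_coloops (M : Matroid α) [M.Finite] {r k : ℕ}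
    (hr : M.eRank = (r : ℕ∞)) (hcol : M.coloops = ∅) {X : Set α} (hX : X ⊆ M.E) (hk : M.eRk X = (k : ℕ∞))
    (hkr : k < r) : r - k + 1 ≤ (M.E \ X).ncard := by
  by_contra hlt
  push Not at hlt
  have hfinD : (M.E \ X).Finite := M.ground_finite.subset sdiff_subset
  have hne : (M.E \ X).Nonempty := by
    rw [nonempty_iff_ne_empty]
    intro h0
    have hsub : M.E ⊆ X := fun y hy => by
      by_contra hyX
      have : y ∈ M.E \ X := ⟨hy, hyX⟩
      rw [h0] at this
      exact this
    have hEq := hX.antisymm hsub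
    rw [hEq, M.eRk_ground, hr] at hk
    have : r = k := by exact_mod_cast hk
    omega
  obtain ⟨y, hy⟩ := hne
  have hsub : X ⊆ M.E \ {y} := fun z hz => ⟨hX hz, fun hzy => hy.2 (by rw [mem_singleton_iff] at hzy; rw [← hzy]; exact hz)⟩
  have h1 := M.eRk_union_le_eRk_add_eRk X ((M.E \ {y}) \ X)
  rw [union_sdiff_cancel hsub] at h1
  have hc : ((M.E \ {y}) \ X).ncard = (M.E \ X).ncard - 1 := by
    have e : (M.E \ {y}) \ X = (M.E \ X) \ {y} := by
      ext z; simp only [mem_sdiff, mem_singleton_iff]; tauto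
    rw [e, ncard_sdiff_singleton_of_mem hy]
  have h2 : M.eRk ((M.E \ {y}) \ X) ≤ (((M.E \ X).ncard - 1 : ℕ) : ℕ∞) := by
    have := M.eRk_le_encard ((M.E \ {y}) \ X)
    rwa [← (M.ground_finite.subset (sdiff_subset.trans sdiff_subset)).cast_ncard_eq, hc] at this
  have h3 : M.eRk (M.E \ {y}) ≤ ((k + ((M.E \ X).ncard - 1) : ℕ) : ℕ∞) := by
    calc M.eRk (M.E \ {y}) ≤ M.eRk X + M.eRk ((M.E \ {y}) \ X) := h1
      _ ≤ (k : ℕ∞) + (((M.E \ X).ncard - 1 : ℕ) : ℕ∞) := add_le_add (le_of_eq hk) h2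
      _ = ((k + ((M.E \ X).ncard - 1) : ℕ) : ℕ∞) := by push_cast; rfl
  have hcolx : M.IsColoop y := by
    rw [Matroid.isColoop_iff_notMem_closure_compl hy.1, mem_closure_iff_eRk_insert_eq M hy.1 sdiff_subset,
      insert_sdiff_self_of_mem hy.1, M.eRk_ground, hr]
    intro heq
    rw [← heq] at h3
    have h3' : r ≤ k + ((M.E \ X).ncard - 1) := by exact_mod_cast h3
    omega
  have hmem : y ∈ M.coloops := hcolx
  rw [hcol] at hmem
  exact hmem

/-- In a coloop-free matroid of rank `r ≥ 3` with all pairs of rank `2`, the closure of a pair has at most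
`|E| − (r − 1)` points. -/
theorem ncard_closure_pair_le_of_coloops' (M : Matroid α) [M.Finite] {r : ℕ} (hr : M.eRank = (r : ℕ∞))
    (hr3 : 3 ≤ r) (hcol : M.coloops = ∅) (hpairs : ∀ e ∈ M.E, ∀ f ∈ M.E, e ≠ f → M.eRk {e, f} = 2)
    {x y : α} (hx : x ∈ M.E) (hy : y ∈ M.E) (hxy : x ≠ y) :
    (M.closure {x, y}).ncard + (r - 1) ≤ M.E.ncard := by
  have hsub : M.closure {x, y} ⊆ M.E := M.closure_subset_ground _
  have hrk : M.eRk (M.closure {x, y}) = ((2 : ℕ) : ℕ∞) := by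
    rw [M.eRk_closure_eq, hpairs x hx y hy hxy]; rfl
  have h := sub_add_one_le_ncard_ground_sdiff_of_coloops M hr hcol hsub hrk (by omega)
  have h2 := ncard_sdiff_add_ncard_of_subset hsub M.ground_finite
  omega

/-- The rank-`2` sets with at least three points. -/
def bigRankTwo (M : Matroid α) : Set (Set α) :=
  {X : Set α | X ⊆ M.E ∧ 3 ≤ X.ncard ∧ M.eRk X = 2}

/-- The incidences «a big rank-`2` set with one of its pairs». -/
def bigPairs (M : Matroid α) : Set (Set α × Set α) :=
  {Q : Set α × Set α | Q.1 ∈ bigRankTwo M ∧ Q.2 ⊆ Q.1 ∧ Q.2.ncard = 2}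

/-- The big rank-`2` sets form a finite set. -/
theorem bigRankTwo_finite (M : Matroid α) [M.Finite] : (bigRankTwo M).Finite :=
  M.ground_finite.finite_subsets.subset (fun _ hX => hX.1)

/-- **THE INCIDENCE DOUBLE COUNT**: if the closure of every pair has at most `4` points, the rank-`2` sets with
at least three points number at most `C(|E|, 2)` — each contains at least `3` pairs, each pair lies in at most
`3` of them. -/
theorem ncard_bigRankTwo_le_choose (M : Matroid α) [M.Finite]
    (hpairs : ∀ e ∈ M.E, ∀ f ∈ M.E, e ≠ f → M.eRk {e, f} = 2)
    (hcl : ∀ x ∈ M.E, ∀ y ∈ M.E, x ≠ y → (M.closure {x, y}).ncard ≤ 4) :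
    (bigRankTwo M).ncard ≤ Nat.choose M.E.ncard 2 := by
  have hTfin := bigRankTwo_finite M
  have hQfin : (bigPairs M).Finite :=
    (M.ground_finite.finite_subsets.prod M.ground_finite.finite_subsets).subset
      (fun Q hQ => ⟨hQ.1.1, hQ.2.1.trans hQ.1.1⟩)
  -- lower side: `3 · #big ≤ #incidences`
  have heq : bigPairs M = ⋃ X ∈ bigRankTwo M, ({X} ×ˢ {P : Set α | P ⊆ X ∧ P.ncard = 2} : Set (Set α × Set α)) := by
    ext ⟨X, P⟩
    simp only [bigPairs, mem_setOf_eq, mem_iUnion, mem_prod, mem_singleton_iff, exists_prop]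
    constructor
    · rintro ⟨hX, hPX, hP2⟩
      exact ⟨X, hX, rfl, hPX, hP2⟩
    · rintro ⟨X', hX', rfl, hPX, hP2⟩
      exact ⟨hX', hPX, hP2⟩
  have hfib : ∀ X ∈ bigRankTwo M, (({X} ×ˢ {P : Set α | P ⊆ X ∧ P.ncard = 2} : Set (Set α × Set α))).Finite :=
    fun X hX => (finite_singleton X).prod ((M.ground_finite.subset hX.1).finite_subsets.subset (fun _ hP => hP.1))
  have hdisj : (bigRankTwo M).PairwiseDisjoint
      (fun X : Set α => ({X} ×ˢ {P : Set α | P ⊆ X ∧ P.ncard = 2} : Set (Set α × Set α))) := by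
    intro X _ X' _ hXX
    rw [Function.onFun, Set.disjoint_left]
    rintro ⟨C, P⟩ ⟨hC1, -⟩ ⟨hC2, -⟩
    apply hXX
    rw [mem_singleton_iff] at hC1 hC2
    rw [← hC1, ← hC2]
  have hlow : 3 * (bigRankTwo M).ncard ≤ (bigPairs M).ncard := by
    rw [heq, hTfin.ncard_biUnion hfib hdisj, finsum_mem_eq_finite_toFinset_sum _ hTfin]
    calc 3 * (bigRankTwo M).ncard = hTfin.toFinset.card • 3 := by
          rw [smul_eq_mul, ncard_eq_toFinset_card _ hTfin, mul_comm]
      _ ≤ ∑ X ∈ hTfin.toFinset, (({X} ×ˢ {P : Set α | P ⊆ X ∧ P.ncard = 2} : Set (Set α × Set α))).ncard := by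
          apply Finset.card_nsmul_le_sum
          intro X hX
          rw [Finite.mem_toFinset] at hX
          rw [ncard_prod, ncard_singleton, one_mul, ncard_setOf_subset_ncard_eq (M.ground_finite.subset hX.1) 2]
          calc 3 = Nat.choose 3 2 := by decide
            _ ≤ Nat.choose X.ncard 2 := Nat.choose_le_choose 2 hX.2.1
  -- upper side: the incidences lie over the pairs of `E`, at most `3` per pair
  have hPfin : {P : Set α | P ⊆ M.E ∧ P.ncard = 2}.Finite :=
    M.ground_finite.finite_subsets.subset (fun _ hP => hP.1)
  have hup : bigPairs M ⊆ ⋃ P ∈ {P : Set α | P ⊆ M.E ∧ P.ncard = 2}, {Q ∈ bigPairs M | Q.2 = P} := by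
    rintro ⟨X, P⟩ ⟨hX, hPX, hP2⟩
    rw [mem_iUnion₂]
    exact ⟨P, ⟨hPX.trans hX.1, hP2⟩, ⟨hX, hPX, hP2⟩, rfl⟩
  have hfibP : ∀ P ∈ {P : Set α | P ⊆ M.E ∧ P.ncard = 2}, {Q ∈ bigPairs M | Q.2 = P}.ncard ≤ 3 := by
    rintro P ⟨hPE, hP2⟩
    obtain ⟨x, y, hxy, rfl⟩ := ncard_eq_two.mp hP2
    have hx : x ∈ M.E := hPE (by simp)
    have hy : y ∈ M.E := hPE (by simp)
    have hclE : M.closure {x, y} ⊆ M.E := M.closure_subset_ground _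
    have hsubcl : ({x, y} : Set α) ⊆ M.closure {x, y} := M.subset_closure _ hPE
    have hrest : (M.closure {x, y} \ {x, y}).ncard ≤ 2 := by
      rw [ncard_sdiff' hsubcl (M.ground_finite.subset hclE), hP2]
      have := hcl x hx y hy hxy
      omega
    have hrestfin : (M.closure {x, y} \ {x, y}).Finite := (M.ground_finite.subset hclE).subset sdiff_subset
    -- the fibre lies in the image of the nonempty subsets of `cl {x, y} ∖ {x, y}` under `S ↦ ({x, y} ∪ S, {x, y})`
    have hsub : {Q ∈ bigPairs M | Q.2 = {x, y}} ⊆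
        (fun S => ({x, y} ∪ S, ({x, y} : Set α))) ''
          {S : Set α | S ⊆ M.closure {x, y} \ {x, y} ∧ 1 ≤ S.ncard} := by
      rintro ⟨X, P⟩ ⟨⟨⟨hXE, hX3, hX2⟩, hPX, -⟩, hPxy⟩
      have hPxy' : P = {x, y} := hPxy
      subst hPxy'
      have hXfin : X.Finite := M.ground_finite.subset hXE
      -- every point of `X` lies in `cl {x, y}`: the rank does not grow
      have hXcl : X ⊆ M.closure {x, y} := by
        intro z hz
        rw [mem_closure_iff_eRk_insert_eq M (hXE hz) hPE]
        have hle : M.eRk (insert z {x, y}) ≤ M.eRk X := M.eRk_mono (insert_subset hz hPX)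
        have hge : M.eRk {x, y} ≤ M.eRk (insert z {x, y}) := M.eRk_mono (subset_insert _ _)
        rw [hX2] at hle
        rw [hpairs x hx y hy hxy] at hge ⊢
        exact le_antisymm hle hge
      refine ⟨X \ {x, y}, ⟨fun z hz => ⟨hXcl hz.1, hz.2⟩, ?_⟩, ?_⟩
      · rw [ncard_sdiff' hPX hXfin, hP2]; omega
      · simp only [Prod.mk.injEq, and_true]
        exact (union_sdiff_cancel hPX).symm ▸ rfl
    have hcount : {S : Set α | S ⊆ M.closure {x, y} \ {x, y} ∧ 1 ≤ S.ncard}.ncard ≤ 3 := by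
      rw [ncard_setOf_subset_one_le_ncard hrestfin]
      have : 2 ^ (M.closure {x, y} \ {x, y}).ncard ≤ 2 ^ 2 := Nat.pow_le_pow_right (by norm_num) hrest
      omega
    exact (ncard_le_ncard hsub ((hrestfin.finite_subsets.subset (fun _ hS => hS.1)).image _)).trans
      ((ncard_image_le (hrestfin.finite_subsets.subset (fun _ hS => hS.1))).trans hcount)
  have hcardP : {P : Set α | P ⊆ M.E ∧ P.ncard = 2}.ncard = Nat.choose M.E.ncard 2 :=
    ncard_setOf_subset_ncard_eq M.ground_finite 2
  have hupper : (bigPairs M).ncard ≤ 3 * Nat.choose M.E.ncard 2 := by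
    calc (bigPairs M).ncard ≤ (⋃ P ∈ {P : Set α | P ⊆ M.E ∧ P.ncard = 2}, {Q ∈ bigPairs M | Q.2 = P}).ncard :=
          ncard_le_ncard hup (hPfin.biUnion (fun P _ => hQfin.subset (fun Q hQ => hQ.1)))
      _ ≤ ∑ᶠ P ∈ {P : Set α | P ⊆ M.E ∧ P.ncard = 2}, {Q ∈ bigPairs M | Q.2 = P}.ncard := hPfin.ncard_biUnion_le _
      _ = ∑ P ∈ hPfin.toFinset, {Q ∈ bigPairs M | Q.2 = P}.ncard := finsum_mem_eq_finite_toFinset_sum _ hPfin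
      _ ≤ hPfin.toFinset.card • 3 := by
          apply Finset.sum_le_card_nsmul
          intro P hP
          rw [Finite.mem_toFinset] at hP
          exact hfibP P hP
      _ = 3 * Nat.choose M.E.ncard 2 := by rw [smul_eq_mul, ← ncard_eq_toFinset_card _ hPfin, hcardP, mul_comm]
  omega


/-- A coloop-free matroid of rank `r` on `n` points has at least `n + 1` spanning sets: the ground set and its
`n` subsets of size `n − 1`. -/
theorem succ_le_ncard_rankSet_top_of_coloops (M : Matroid α) [M.Finite] {r : ℕ} (hr : M.eRank = (r : ℕ∞))
    (hcol : M.coloops = ∅) : M.E.ncard + 1 ≤ (rankSet M r).ncard := by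
  have hE : M.E ∈ rankSet M r := ⟨subset_rfl, by rw [M.eRk_ground, hr]⟩
  have hsub : insert M.E ((fun x => M.E \ {x}) '' M.E) ⊆ rankSet M r := by
    rintro A (rfl | ⟨x, hx, rfl⟩)
    · exact hE
    · refine ⟨sdiff_subset, ?_⟩
      have hcolx : ¬ M.IsColoop x := fun h => by
        have hmem : x ∈ M.coloops := h
        rw [hcol] at hmem
        exact hmem
      rw [Matroid.isColoop_iff_notMem_closure_compl hx, not_not,
        mem_closure_iff_eRk_insert_eq M hx sdiff_subset, insert_sdiff_self_of_mem hx, M.eRk_ground, hr] at hcolx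
      exact hcolx.symm
  have hnot : M.E ∉ (fun x => M.E \ {x}) '' M.E := by
    rintro ⟨x, hx, hxE⟩
    have hxE' : M.E \ {x} = M.E := hxE
    have : x ∈ M.E \ {x} := by rw [hxE']; exact hx
    exact this.2 rfl
  have himg : ((fun x => M.E \ {x}) '' M.E).ncard = M.E.ncard := by
    rw [InjOn.ncard_image]
    intro x hx y hy hxy
    have hxy' : M.E \ {x} = M.E \ {y} := hxy
    by_contra hne
    have : y ∈ M.E \ {x} := ⟨hy, fun h => hne (by rw [mem_singleton_iff] at h; exact h.symm)⟩
    rw [hxy'] at this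
    exact this.2 rfl
  have h := ncard_le_ncard hsub (rankSet_finite M r)
  rw [ncard_insert_of_notMem hnot (M.ground_finite.image _), himg] at h
  omega

/-- `f(2) ≤ C(|E|, 2) + #big`: a rank-`2` set is a pair or big. -/
theorem ncard_rankSet_two_le_add_big (M : Matroid α) [M.Finite] :
    (rankSet M 2).ncard ≤ Nat.choose M.E.ncard 2 + (bigRankTwo M).ncard := by
  have hsub : rankSet M 2 ⊆ {A : Set α | A ⊆ M.E ∧ A.ncard = 2} ∪ bigRankTwo M := by
    rintro A ⟨hAE, hA2⟩
    have hAfin : A.Finite := M.ground_finite.subset hAE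
    have h2 : 2 ≤ A.ncard := by
      have := M.eRk_le_encard A
      rw [hA2, ← hAfin.cast_ncard_eq] at this
      exact_mod_cast this
    rcases Nat.lt_or_ge A.ncard 3 with h | h
    · left; exact ⟨hAE, by omega⟩
    · right; exact ⟨hAE, h, hA2⟩
  have h := ncard_le_ncard hsub ((M.ground_finite.finite_subsets.subset (fun _ hA => hA.1)).union
    (bigRankTwo_finite M))
  refine h.trans ((ncard_union_le _ _).trans ?_)
  rw [ncard_setOf_subset_ncard_eq M.ground_finite 2]

/-- `N_M(4, 2) ≤ C(7, 5) + #big` on `7` points of rank `4`: a spanning set whose complement has rank `2` has `5`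
points (complement a pair) or `4` points (complement a big rank-`2` triple). -/
theorem ncard_profileSet_four_two_le_add (M : Matroid α) [M.Finite] (hE : M.E.ncard = 7) :
    (profileSet M 4 2).ncard ≤ 21 + (bigRankTwo M).ncard := by
  have hfin5 : {A : Set α | A ⊆ M.E ∧ A.ncard = 5}.Finite :=
    M.ground_finite.finite_subsets.subset (fun _ hA => hA.1)
  have hsub : profileSet M 4 2 ⊆ {A : Set α | A ⊆ M.E ∧ A.ncard = 5} ∪ (fun T => M.E \ T) '' bigRankTwo M := by
    rintro A ⟨hAE, hA4, hAc⟩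
    have hAfin : A.Finite := M.ground_finite.subset hAE
    have h1 : ((4 : ℕ) : ℕ∞) ≤ (A.ncard : ℕ∞) := by
      rw [← hA4, hAfin.cast_ncard_eq]; exact M.eRk_le_encard A
    have h2 : ((2 : ℕ) : ℕ∞) ≤ ((M.E \ A).ncard : ℕ∞) := by
      rw [← hAc, (M.ground_finite.subset sdiff_subset).cast_ncard_eq]; exact M.eRk_le_encard _
    have h3 : A.ncard + (M.E \ A).ncard = M.E.ncard := by
      rw [← ncard_union_eq disjoint_sdiff_right hAfin (M.ground_finite.subset sdiff_subset), union_sdiff_cancel hAE]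
    have h1' : 4 ≤ A.ncard := by exact_mod_cast h1
    have h2' : 2 ≤ (M.E \ A).ncard := by exact_mod_cast h2
    rcases Nat.lt_or_ge A.ncard 5 with h | h
    · right
      refine ⟨M.E \ A, ⟨sdiff_subset, by omega, hAc⟩, ?_⟩
      exact sdiff_sdiff_cancel_left hAE
    · left
      exact ⟨hAE, by omega⟩
  have h := ncard_le_ncard hsub (hfin5.union ((bigRankTwo_finite M).image _))
  refine h.trans ((ncard_union_le _ _).trans ?_)
  rw [ncard_setOf_subset_ncard_eq M.ground_finite 5, hE, show Nat.choose 7 5 = 21 by decide]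
  exact Nat.add_le_add_left (ncard_image_le (bigRankTwo_finite M)) _

/-- `f(2) + f(3) + f(4) ≥ 2^|E| − 1 − |E|` when all pairs have rank `2` and the rank is `4`: every set with at
least two points has rank `2`, `3` or `4`. -/
theorem ncard_rankSet_two_three_four_ge_of_pairs (M : Matroid α) [M.Finite] (hM : M.eRank = ((4 : ℕ) : ℕ∞))
    (hpairs : ∀ e ∈ M.E, ∀ f ∈ M.E, e ≠ f → M.eRk {e, f} = 2) :
    2 ^ M.E.ncard - 1 - M.E.ncard ≤ (rankSet M 2).ncard + (rankSet M 3).ncard + (rankSet M 4).ncard := by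
  have hsub : {A : Set α | A ⊆ M.E ∧ 2 ≤ A.ncard} ⊆ rankSet M 2 ∪ rankSet M 3 ∪ rankSet M 4 := by
    rintro A ⟨hAE, h2⟩
    have hlo := two_le_eRk_of_two_le_ncard hpairs hAE h2
    have hhi := M.eRk_le_eRank A
    rw [hM] at hhi
    obtain ⟨n, hn⟩ := ENat.ne_top_iff_exists.mp (ne_top_of_le_ne_top (by decide) hhi)
    rw [← hn] at hlo hhi
    have hlo' : 2 ≤ n := by exact_mod_cast hlo
    have hhi' : n ≤ 4 := by exact_mod_cast hhi
    have hmem : ∀ k, n = k → A ∈ rankSet M k := fun k hk => ⟨hAE, by rw [← hn, hk]⟩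
    rcases Nat.lt_or_ge n 3 with h | h
    · exact Or.inl (Or.inl (hmem 2 (by omega)))
    rcases Nat.lt_or_ge n 4 with h' | h'
    · exact Or.inl (Or.inr (hmem 3 (by omega)))
    · exact Or.inr (hmem 4 (by omega))
  have h := ncard_le_ncard hsub (((rankSet_finite M 2).union (rankSet_finite M 3)).union (rankSet_finite M 4))
  rwa [ncard_setOf_subset_two_le_ncard M.ground_finite,
    ncard_union_eq (Set.disjoint_union_left.mpr
      ⟨rankSet_disjoint_of_ne M (by norm_num), rankSet_disjoint_of_ne M (by norm_num)⟩)
      ((rankSet_finite M 2).union (rankSet_finite M 3)) (rankSet_finite M 4),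
    ncard_union_eq (rankSet_disjoint_of_ne M (by norm_num)) (rankSet_finite M 2) (rankSet_finite M 3)] at h

end S1

end PercRepro
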